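import Summits.Ventures.CertifiedManyBodySolver.Theses.CovHg1201M19
import Summits.Ventures.CertifiedManyBodySolver.Rows.DopedTLCorrBundleWN
import Summits.Ventures.CertifiedManyBodySolver.Rows.DopedTLCorrBox
import Summits.Ventures.CertifiedManyBodySolver.Certificates.HubbardSquare_hg1201M19_stripCaps
import Summits.Ventures.CertifiedManyBodySolver.Observables.StiffnessApexTransportTargetSlot
import Summits.Ventures.CertifiedManyBodySolver.Observables.RungLeavesCoverageHg1201PatchL
import Summits.Ventures.CertifiedManyBodySolver.Observables.StiffnessTLKineticTT
import Summits.Ventures.CertifiedManyBodySolver.Downfold.BoxesHg1201EStationKinematicsM19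
import HarnessLib

/-!
# Ventures/CertifiedManyBodySolver — Theorems/CovHg1201M19BundleWNClosers.lean

HONEST FRAMING: zero-solve CLOSERS (pure bookkeeping) for crux «PatchLeftEdgeM19» (stmt-Ventures-27755) of route `CovHg1201M19` — the M19 COLUMN (box `boxHg1201E_M19`,
`n`-top `22/25`, bar′ `0.5084577 = 0.98 × 0.5188344`) of the HgBa₂CuO₄₊δ «Hg-1201» coverage programme (D-0154 (1)(C)); the M19 twin of this seat's M19b chain
`Theorems/CovHg1201M19b{PatchAdapters (g0), BoxRowWAdapters (g0), BundleWNClosers}`. The route item is ALREADY the certificate strip (captain/box-2 kinematic cuts inside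
`closes`): `PatchLeftEdgeM19` = for every `n ∈ [43/50, 22/25]`, `σ ∈ [−27/50, −53/100]`, `U′ ∈ [7/2, 44/5]`, every torus-limit sector GS at `(−27/50, U′, n)`:
`−0.5084577 ≤ |D₄|⁻¹ Σ_γ Re ω_γ(−X₀(σ, U′))`. This file turns PINNED-PAIR U-segment reads of the M19 left edge (vertex legs A′7o2 j305091 / A′5 j305093 / A′44o5, hubbard-cov-hg1201-sdp-2;
nodes `cert_hg1201_Atop*`), typed in the bundle-WN shape `SquareTTPrimeBundleOrbitLowerRowWN` (density extent by the families' own filling multipliers, captain ruling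
C-S1 (5) CALLED), into the item: §1 the corner-objective ⇒ target-slot adapter at M19 (chord with the kinematic `−13/25` END reading `hg1201M19_kinematicReading_le_bar`,
box-2 g0), §2 thick-cell (`[43/50, 22/25]`) per-cell closers from ONE bundle-WN node with the window functions of `Certificates/HubbardSquare_hg1201M19_stripCaps.lean`
(top HF plane for the low-`U` cells, polarised constant for the high cells, kinematic floor), §3 glue (union / chain) and the item closers
`covHg1201M19_PatchLeftEdgeM19_of_twoCells / _fourCells / _chain`. No def. Nothing here is a certificate or a number of record; CONTROL / CALIBRATION class words only
flow through it (xx1; «content» = below 0.98 × the M19 kinematic MAJORANT, no suppression below free claimed); a ceiling never speaks to the presence of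
superconductivity; not a `T_c` / phase sentence; nothing about HgBa₂CuO₄₊δ; no item is closed by this file alone. Seat `hubbard-cov-hg1201-box-1` (`prover-hubbard-cov-hg1201-box-1-g0-0`).

References: S. Boyd, L. Vandenberghe, *Convex Optimization* (2004) §5.9 [BoydVandenberghe2004]; T. Koma, H. Tasaki, J. Stat. Phys. 76 (1994) 745, §1 [KomaTasaki1994];
D. J. Scalapino, S. R. White, S.-C. Zhang, PRB 47 (1993) 7995, §II [ScalapinoWhiteZhang1993]; J. Wang et al., PRX 14 (2024) 031006, §III [WangEtAl2024].
-/

noncomputable section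

namespace Summit.Ventures.CertifiedManyBodySolver.Theorems

open Real Set Filter Topology
open Summit.Ventures.CertifiedManyBodySolver.Observables
open Summit.Ventures.CertifiedManyBodySolver.Downfold
open Summit.Ventures.CertifiedManyBodySolver.Certificates
open Summit.Ventures.CertifiedManyBodySolver
open Summit.Ventures.CertifiedManyBodySolver.Theses.CovHg1201M19 (PatchLeftEdgeM19)
open Literature.MathematicalPhysics.QuantumLattice Literature.MathematicalPhysics.QuantumLattice.ThermodynamicLimit
open Literature.Probability.LatticeModels
open Matrix HubbardWave0
open scoped BigOperators ComplexOrder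

/-! ## §0 Local helpers (private copies of route-cone one-liners of `CovHg1201M19bPatchAdapters`) -/

/-- At `λ = 0` the odd-moment objective does not depend on the Hamiltonian's `U` label (local copy of g0's route-cone one-liner). [folklore] -/
private theorem m19_neg_oddMomentObsTT_lam_zero_label (tp U U' : ℝ) : -oddMomentObsTT tp U 0 = -oddMomentObsTT tp U' 0 := by
  rw [oddMomentObsTT_lam_zero tp U, oddMomentObsTT_lam_zero tp U']

/-- Membership of a literal triple in a literal `Fin 3` box, router order `(U, t′, n)` (local copy). [folklore] -/
private theorem m19_vec3_mem_Icc {a b c a' b' c' x y z : ℝ} (hx : a ≤ x) (hx' : x ≤ a') (hy : b ≤ y) (hy' : y ≤ b') (hz : c ≤ z) (hz' : z ≤ c') :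
    (![x, y, z] : Fin 3 → ℝ) ∈ Set.Icc (![a, b, c] : Fin 3 → ℝ) ![a', b', c'] := by
  refine ⟨fun i => ?_, fun i => ?_⟩ <;> fin_cases i <;> simp [hx, hx', hy, hy', hz, hz']

/-! ## §1 Corner objective ⇒ every target slot (M19 bar′), from ONE windowed box row on a left cell -/

/-- **LEFT-EDGE FAMILY at M19 from CORNER-OBJECTIVE reads**: per `n ∈ [n₁, n₂] ⊆ [0, 22/25]` and label `U′ ∈ [U₁, U₂]` an orbit-lower value `vL n U′` for the CORNER
objective `−X₀(−27/50)` on the class at `(−27/50, U′, n)` with `−vL ≤ 0.5084577` ⇒ the target-slot word at every `σ ∈ [−27/50, −13/25]`: the `σ`-chord of that value with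
the kinematic inner-END read `−X₀(−13/25)` (`halfBathtub_m13o25_M19chordLevel_le`, ≤ bar′ for `n ≤ 22/25` by `hg1201M19_kinematicReading_le_bar`, box-2 g0). M19 twin of
g0's `covHg1201M19b_leftEdgeSegment_of_cornerObjective`. [cite: KomaTasaki1994, §1] [cite: ScalapinoWhiteZhang1993, §II] -/
theorem covHg1201M19_leftEdgeSegment_of_cornerObjective {U₁ U₂ n₁ n₂ : ℝ} (hn₁ : 0 ≤ n₁) (hn₂ : n₂ ≤ 22 / 25) (vL : ℝ → ℝ → ℝ)
    (hL : ∀ n ∈ Set.Icc n₁ n₂, ∀ U' ∈ Set.Icc U₁ U₂,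
      ∀ (ω : InfVolFermionState 2) (Ls : ℕ → ℕ) (ψ : ∀ L, Fock (Orb (FermionTorus 2 L))),
      Tendsto Ls atTop atTop →
      (∀ j, IsGroundStateInSector (hubbardTorusTT' (Ls j) 1 (-27 / 50) U') (rectN n (Ls j)) 0 (ψ (Ls j))) →
      (∀ j, star (ψ (Ls j)) ⬝ᵥ ψ (Ls j) = 1) → ω.IsTorusLimitOf ψ Ls →
      vL n U' ≤ ((Finset.univ : Finset (DihedralGroup 4)).card : ℝ)⁻¹ * ∑ g ∈ (Finset.univ : Finset (DihedralGroup 4)),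
        (ω.expect (d4ShiftSet g 0 (box 2 7)) (fermionEmbed (PolySite.d4Emb g 0 (box 2 7)) (-oddMomentObsTT (-27 / 50) U' 0))).re)
    (hcL : ∀ n ∈ Set.Icc n₁ n₂, ∀ U' ∈ Set.Icc U₁ U₂, -vL n U' ≤ (5084577 / 10000000 : ℝ)) :
    ∀ n ∈ Set.Icc (n₁ : ℝ) (n₂), ∀ σ ∈ Set.Icc (-27 / 50 : ℝ) (-13 / 25), ∀ U' ∈ Set.Icc U₁ U₂,
      ∀ (ω : InfVolFermionState 2) (Ls : ℕ → ℕ) (ψ : ∀ L, Fock (Orb (FermionTorus 2 L))),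
      Tendsto Ls atTop atTop →
      (∀ j, IsGroundStateInSector (hubbardTorusTT' (Ls j) 1 (-27 / 50) U') (rectN n (Ls j)) 0 (ψ (Ls j))) →
      (∀ j, star (ψ (Ls j)) ⬝ᵥ ψ (Ls j) = 1) → ω.IsTorusLimitOf ψ Ls →
      -(5084577 / 10000000 : ℝ) ≤ ((Finset.univ : Finset (DihedralGroup 4)).card : ℝ)⁻¹ * ∑ g ∈ (Finset.univ : Finset (DihedralGroup 4)),
        (ω.expect (d4ShiftSet g 0 (box 2 7)) (fermionEmbed (PolySite.d4Emb g 0 (box 2 7)) (-oddMomentObsTT σ U' 0))).re := by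
  intro n hn σ hσ U' hU' ω Ls ψ hLs hψ h1 hω
  have hn0 : 0 ≤ n := hn₁.trans hn.1
  have hn' : n ≤ 22 / 25 := hn.2.trans hn₂
  have hn2 : n < 2 := by linarith
  have hKQc : -(-((22711 / 45056 : ℝ) * n / 2 + ((9 / 11 : ℝ) * 0.3036683458 + 2 / 11 * 0.1996934694))) ≤ (5084577 / 10000000 : ℝ) := by
    rw [neg_neg]
    have h := hg1201M19_kinematicReading_le_bar hn'
    linarith
  have hchord := orbitLower_slot_chord_of_two_endObjectives hω.isTranslationInvariant U' (by norm_num : (-27 / 50 : ℝ) < -13 / 25) hσ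
    (hL n hn U' hU' ω Ls ψ hLs hψ h1 hω)
    (orbitMean_neg_oddMomentTT_lam_zero_ge_kinematic_of_gs (-13 / 25) U' (-27 / 50) U' halfBathtub_m13o25_M19chordLevel_le hn0 hn2 ω Ls ψ hLs hψ h1 hω)
  obtain ⟨ha, hb, hab⟩ := hg1201_patch_slotWeights hσ
  have hprice := neg_convexComb_le_of_neg_le ha hb hab (hcL n hn U' hU') hKQc
  linarith

/-- **LEFT-EDGE FAMILY at M19 from ONE WINDOWED box row** `SquareTTPrimeCorrOrbitLowerBoxRowW ![U₁, −27/50, n₁] ![U₂, −27/50, n₂] flo cap r univ Λ₇ (−X₀(−27/50; Uo))`, window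
functions discharged on the cell (`hflo`, `hcap`), `−r ≤ 0.5084577` ⇒ the family at every slot `σ ∈ [−27/50, −13/25]`. [cite: WangEtAl2024, §III] [cite: KomaTasaki1994, §1] -/
theorem covHg1201M19_leftEdgeSegment_of_boxRowW {U₁ U₂ n₁ n₂ : ℝ} (hn₁ : 0 ≤ n₁) (hn₂ : n₂ ≤ 22 / 25) {flo cap : (Fin 3 → ℝ) → ℝ} {r : ℚ} (Uo : ℝ)
    (hrow : SquareTTPrimeCorrOrbitLowerBoxRowW ![U₁, -27 / 50, n₁] ![U₂, -27 / 50, n₂] flo cap r Finset.univ (box 2 7) (-oddMomentObsTT (-27 / 50) Uo 0))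
    (hflo : ∀ θ ∈ Set.Icc (![U₁, -27 / 50, n₁] : Fin 3 → ℝ) ![U₂, -27 / 50, n₂], flo θ ≤ energyDensityTT' 1 (θ 1) (θ 0) (θ 2))
    (hcap : ∀ θ ∈ Set.Icc (![U₁, -27 / 50, n₁] : Fin 3 → ℝ) ![U₂, -27 / 50, n₂], energyDensityTT' 1 (θ 1) (θ 0) (θ 2) ≤ cap θ)
    (hr : -((r : ℚ) : ℝ) ≤ (5084577 / 10000000 : ℝ)) :
    ∀ n ∈ Set.Icc (n₁ : ℝ) (n₂), ∀ σ ∈ Set.Icc (-27 / 50 : ℝ) (-13 / 25), ∀ U' ∈ Set.Icc U₁ U₂,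
      ∀ (ω : InfVolFermionState 2) (Ls : ℕ → ℕ) (ψ : ∀ L, Fock (Orb (FermionTorus 2 L))),
      Tendsto Ls atTop atTop →
      (∀ j, IsGroundStateInSector (hubbardTorusTT' (Ls j) 1 (-27 / 50) U') (rectN n (Ls j)) 0 (ψ (Ls j))) →
      (∀ j, star (ψ (Ls j)) ⬝ᵥ ψ (Ls j) = 1) → ω.IsTorusLimitOf ψ Ls →
      -(5084577 / 10000000 : ℝ) ≤ ((Finset.univ : Finset (DihedralGroup 4)).card : ℝ)⁻¹ * ∑ g ∈ (Finset.univ : Finset (DihedralGroup 4)),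
        (ω.expect (d4ShiftSet g 0 (box 2 7)) (fermionEmbed (PolySite.d4Emb g 0 (box 2 7)) (-oddMomentObsTT σ U' 0))).re := by
  refine covHg1201M19_leftEdgeSegment_of_cornerObjective hn₁ hn₂ (fun _ _ => ((r : ℚ) : ℝ))
    (fun n hn U' hU' ω Ls ψ hLs hψ h1 hω => ?_) (fun n hn U' hU' => hr)
  rw [m19_neg_oddMomentObsTT_lam_zero_label (-27 / 50) U' Uo]
  have hθ : (![U', -27 / 50, n] : Fin 3 → ℝ) ∈ Set.Icc (![U₁, -27 / 50, n₁] : Fin 3 → ℝ) ![U₂, -27 / 50, n₂] :=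
    m19_vec3_mem_Icc hU'.1 hU'.2 le_rfl le_rfl hn.1 hn.2
  have hf := hflo _ hθ
  have hc := hcap _ hθ
  have hh := hrow _ hθ ω Ls ψ hLs
  simp only [Matrix.cons_val_zero, Matrix.cons_val_one, Matrix.head_cons, Matrix.cons_val_two, Matrix.tail_cons] at hf hc hh
  exact hh hψ h1 hω hf hc

/-! ## §2 The thick cell `[U₁, U₂] × {−27/50} × [43/50, 22/25]` from ONE bundle-WN node (read at `22/25`) -/

/-- The STRIP SLOT of an M19 bundle-WN read solved at `22/25`, `min F (min (F + sl₁·(43/50 − 22/25)) (F + sl₂·(43/50 − 22/25)))`, is below the four end values.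
[folklore] -/
theorem m19_bundleWNStripSlot_le (F sl₁ sl₂ : ℚ) :
    (min F (min (F + sl₁ * (43 / 50 - 22 / 25)) (F + sl₂ * (43 / 50 - 22 / 25)))) ≤ F + sl₁ * (43 / 50 - 22 / 25) ∧
    (min F (min (F + sl₁ * (43 / 50 - 22 / 25)) (F + sl₂ * (43 / 50 - 22 / 25)))) ≤ F + sl₁ * (22 / 25 - 22 / 25) ∧
    (min F (min (F + sl₁ * (43 / 50 - 22 / 25)) (F + sl₂ * (43 / 50 - 22 / 25)))) ≤ F + sl₂ * (43 / 50 - 22 / 25) ∧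
    (min F (min (F + sl₁ * (43 / 50 - 22 / 25)) (F + sl₂ * (43 / 50 - 22 / 25)))) ≤ F + sl₂ * (22 / 25 - 22 / 25) := by
  refine ⟨?_, ?_, ?_, ?_⟩
  · exact (min_le_right _ _).trans (min_le_left _ _)
  · simp only [sub_self, mul_zero, add_zero]; exact min_le_left _ _
  · exact (min_le_right _ _).trans (min_le_right _ _)
  · simp only [sub_self, mul_zero, add_zero]; exact min_le_left _ _

/-- The PRICE of the M19 strip slot from the three end prices. [folklore] -/
theorem m19_neg_bundleWNStripSlot_le {F sl₁ sl₂ c : ℚ} (p₀ : -F ≤ c) (p₁ : -F - sl₁ * (43 / 50 - 22 / 25) ≤ c)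
    (p₂ : -F - sl₂ * (43 / 50 - 22 / 25) ≤ c) :
    -(((min F (min (F + sl₁ * (43 / 50 - 22 / 25)) (F + sl₂ * (43 / 50 - 22 / 25)))) : ℚ) : ℝ) ≤ ((c : ℚ) : ℝ) := by
  have h : -((min F (min (F + sl₁ * (43 / 50 - 22 / 25)) (F + sl₂ * (43 / 50 - 22 / 25))))) ≤ c := by
    rcases min_choice F (min (F + sl₁ * (43 / 50 - 22 / 25)) (F + sl₂ * (43 / 50 - 22 / 25))) with h | h <;> rw [h]
    · linarith
    · rcases min_choice (F + sl₁ * (43 / 50 - 22 / 25)) (F + sl₂ * (43 / 50 - 22 / 25)) with h' | h' <;> rw [h'] <;> linarith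
  exact_mod_cast h

/-- **THICK BOX ROW of an M19 left-edge bundle-WN node** (family on `[U₁, U₂] × {−27/50}` read at `22/25`): the windowed row on `![U₁, −27/50, 43/50] … ![U₂, −27/50, 22/25]`
with the strip slot. [cite: BoydVandenberghe2004, §5.9] -/
theorem covHg1201M19_leftThickCell_boxRowW_of_bundleWN {U₁ U₂ : ℝ} {flo cap : ℝ → ℝ → ℝ} {F sl₁ sl₂ : ℚ} {X : FermionOp (box 2 7)}
    (hrow : SquareTTPrimeBundleOrbitLowerRowWN U₁ U₂ (-27 / 50) (-27 / 50) flo cap F sl₁ sl₂ (22 / 25) Finset.univ (box 2 7) X) :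
    SquareTTPrimeCorrOrbitLowerBoxRowW ![U₁, -27 / 50, 43 / 50] ![U₂, -27 / 50, 22 / 25] (fun θ => flo (θ 0) (θ 1)) (fun θ => cap (θ 0) (θ 1))
      (min F (min (F + sl₁ * (43 / 50 - 22 / 25)) (F + sl₂ * (43 / 50 - 22 / 25)))) Finset.univ (box 2 7) X := by
  obtain ⟨a, b, c, d⟩ := m19_bundleWNStripSlot_le F sl₁ sl₂
  have h := hrow.orbitLowerBoxRowW_thick_rat (n₁ := 43 / 50) (n₂ := 22 / 25) (by norm_num) (by norm_num) a b c d
  have e1 : (((43 / 50 : ℚ)) : ℝ) = 43 / 50 := by norm_num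
  have e2 : (((22 / 25 : ℚ)) : ℝ) = 22 / 25 := by norm_num
  rw [e1, e2] at h
  exact h

/-- **M19 LEFT-EDGE FAMILY ON A THICK `U`-CELL from ONE bundle-WN node** (PINNED pair on `[U₁, U₂] × {−27/50}` solved at `22/25`, corner objective), window functions
discharged on the thick cell (`hflo`, `hcap`), three prices `−F ≤ bar′`, `−F − sl_j·(−1/50) ≤ bar′`. [cite: ScalapinoWhiteZhang1993, §II] [cite: BoydVandenberghe2004, §5.9] -/
theorem covHg1201M19_leftEdgeStripCell_of_bundleWN {U₁ U₂ : ℝ} {flo cap : ℝ → ℝ → ℝ} {F sl₁ sl₂ : ℚ} (Uo : ℝ)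
    (hrow : SquareTTPrimeBundleOrbitLowerRowWN U₁ U₂ (-27 / 50) (-27 / 50) flo cap F sl₁ sl₂ (22 / 25) Finset.univ (box 2 7) (-oddMomentObsTT (-27 / 50) Uo 0))
    (hflo : ∀ θ ∈ Set.Icc (![U₁, -27 / 50, 43 / 50] : Fin 3 → ℝ) ![U₂, -27 / 50, 22 / 25], flo (θ 0) (θ 1) ≤ energyDensityTT' 1 (θ 1) (θ 0) (θ 2))
    (hcap : ∀ θ ∈ Set.Icc (![U₁, -27 / 50, 43 / 50] : Fin 3 → ℝ) ![U₂, -27 / 50, 22 / 25], energyDensityTT' 1 (θ 1) (θ 0) (θ 2) ≤ cap (θ 0) (θ 1))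
    (p₀ : -F ≤ 5084577 / 10000000) (p₁ : -F - sl₁ * (43 / 50 - 22 / 25) ≤ 5084577 / 10000000)
    (p₂ : -F - sl₂ * (43 / 50 - 22 / 25) ≤ 5084577 / 10000000) :
    ∀ n ∈ Set.Icc (43 / 50 : ℝ) (22 / 25), ∀ σ ∈ Set.Icc (-27 / 50 : ℝ) (-13 / 25), ∀ U' ∈ Set.Icc U₁ U₂,
      ∀ (ω : InfVolFermionState 2) (Ls : ℕ → ℕ) (ψ : ∀ L, Fock (Orb (FermionTorus 2 L))),
      Tendsto Ls atTop atTop →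
      (∀ j, IsGroundStateInSector (hubbardTorusTT' (Ls j) 1 (-27 / 50) U') (rectN n (Ls j)) 0 (ψ (Ls j))) →
      (∀ j, star (ψ (Ls j)) ⬝ᵥ ψ (Ls j) = 1) → ω.IsTorusLimitOf ψ Ls →
      -(5084577 / 10000000 : ℝ) ≤ ((Finset.univ : Finset (DihedralGroup 4)).card : ℝ)⁻¹ * ∑ g ∈ (Finset.univ : Finset (DihedralGroup 4)),
        (ω.expect (d4ShiftSet g 0 (box 2 7)) (fermionEmbed (PolySite.d4Emb g 0 (box 2 7)) (-oddMomentObsTT σ U' 0))).re := by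
  have hr := m19_neg_bundleWNStripSlot_le p₀ p₁ p₂
  have e : (((5084577 / 10000000 : ℚ)) : ℝ) = (5084577 / 10000000 : ℝ) := by norm_num
  rw [e] at hr
  exact covHg1201M19_leftEdgeSegment_of_boxRowW (by norm_num) le_rfl Uo (covHg1201M19_leftThickCell_boxRowW_of_bundleWN hrow)
    (fun θ hθ => hflo θ hθ) (fun θ hθ => hcap θ hθ) hr

/-- **LOW-`U` INSTANCE** (the A′7o2 ↔ A′5 family shape, caps ON the top HF plane `−15927782/10⁷ + U·121/625`, floor kinematic; `31/10 ≤ U₁`): only the node and three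
rational prices remain. [cite: ScalapinoWhiteZhang1993, §II] -/
theorem covHg1201M19_leftEdgeStripCell_of_bundleWN_topPlane {U₁ U₂ : ℝ} (hU₁ : 31 / 10 ≤ U₁) {F sl₁ sl₂ : ℚ} (Uo : ℝ)
    (hrow : SquareTTPrimeBundleOrbitLowerRowWN U₁ U₂ (-27 / 50) (-27 / 50) (fun (_ _ : ℝ) => (((-124827703/50000000 : ℚ)) : ℝ))
      (fun (U _ : ℝ) => ((-15927782/10000000 : ℚ) : ℝ) + U * ((121/625 : ℚ) : ℝ)) F sl₁ sl₂ (22 / 25) Finset.univ (box 2 7)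
      (-oddMomentObsTT (-27 / 50) Uo 0))
    (p₀ : -F ≤ 5084577 / 10000000) (p₁ : -F - sl₁ * (43 / 50 - 22 / 25) ≤ 5084577 / 10000000)
    (p₂ : -F - sl₂ * (43 / 50 - 22 / 25) ≤ 5084577 / 10000000) :
    ∀ n ∈ Set.Icc (43 / 50 : ℝ) (22 / 25), ∀ σ ∈ Set.Icc (-27 / 50 : ℝ) (-13 / 25), ∀ U' ∈ Set.Icc U₁ U₂,
      ∀ (ω : InfVolFermionState 2) (Ls : ℕ → ℕ) (ψ : ∀ L, Fock (Orb (FermionTorus 2 L))),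
      Tendsto Ls atTop atTop →
      (∀ j, IsGroundStateInSector (hubbardTorusTT' (Ls j) 1 (-27 / 50) U') (rectN n (Ls j)) 0 (ψ (Ls j))) →
      (∀ j, star (ψ (Ls j)) ⬝ᵥ ψ (Ls j) = 1) → ω.IsTorusLimitOf ψ Ls →
      -(5084577 / 10000000 : ℝ) ≤ ((Finset.univ : Finset (DihedralGroup 4)).card : ℝ)⁻¹ * ∑ g ∈ (Finset.univ : Finset (DihedralGroup 4)),
        (ω.expect (d4ShiftSet g 0 (box 2 7)) (fermionEmbed (PolySite.d4Emb g 0 (box 2 7)) (-oddMomentObsTT σ U' 0))).re :=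
  covHg1201M19_leftEdgeStripCell_of_bundleWN Uo hrow (covHg1201M19_leftThickCell_kinFloorFn (by linarith))
    (covHg1201M19_leftThickCell_topPlaneCap hU₁) p₀ p₁ p₂

/-- **CONSTANT-CAP INSTANCE** (a high-`U` family booked with the polarised constant `c`, e.g. `−113/200`; floor kinematic; `0 ≤ U₁`): NODE-FREE windows.
[cite: ScalapinoWhiteZhang1993, §II] -/
theorem covHg1201M19_leftEdgeStripCell_of_bundleWN_constCap {U₁ U₂ : ℝ} (hU₁ : 0 ≤ U₁) {c F sl₁ sl₂ : ℚ} (Uo : ℝ)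
    (hc₁ : (-6322759499/10000000000 : ℚ) ≤ c) (hc₂ : (-5670932507/10000000000 : ℚ) ≤ c)
    (hrow : SquareTTPrimeBundleOrbitLowerRowWN U₁ U₂ (-27 / 50) (-27 / 50) (fun (_ _ : ℝ) => (((-124827703/50000000 : ℚ)) : ℝ))
      (fun (_ _ : ℝ) => ((c : ℚ) : ℝ)) F sl₁ sl₂ (22 / 25) Finset.univ (box 2 7) (-oddMomentObsTT (-27 / 50) Uo 0))
    (p₀ : -F ≤ 5084577 / 10000000) (p₁ : -F - sl₁ * (43 / 50 - 22 / 25) ≤ 5084577 / 10000000)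
    (p₂ : -F - sl₂ * (43 / 50 - 22 / 25) ≤ 5084577 / 10000000) :
    ∀ n ∈ Set.Icc (43 / 50 : ℝ) (22 / 25), ∀ σ ∈ Set.Icc (-27 / 50 : ℝ) (-13 / 25), ∀ U' ∈ Set.Icc U₁ U₂,
      ∀ (ω : InfVolFermionState 2) (Ls : ℕ → ℕ) (ψ : ∀ L, Fock (Orb (FermionTorus 2 L))),
      Tendsto Ls atTop atTop →
      (∀ j, IsGroundStateInSector (hubbardTorusTT' (Ls j) 1 (-27 / 50) U') (rectN n (Ls j)) 0 (ψ (Ls j))) →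
      (∀ j, star (ψ (Ls j)) ⬝ᵥ ψ (Ls j) = 1) → ω.IsTorusLimitOf ψ Ls →
      -(5084577 / 10000000 : ℝ) ≤ ((Finset.univ : Finset (DihedralGroup 4)).card : ℝ)⁻¹ * ∑ g ∈ (Finset.univ : Finset (DihedralGroup 4)),
        (ω.expect (d4ShiftSet g 0 (box 2 7)) (fermionEmbed (PolySite.d4Emb g 0 (box 2 7)) (-oddMomentObsTT σ U' 0))).re :=
  covHg1201M19_leftEdgeStripCell_of_bundleWN Uo hrow (covHg1201M19_leftThickCell_kinFloorFn hU₁)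
    (covHg1201M19_leftThickCell_constCap_of_polCaps hU₁ hc₁ hc₂) p₀ p₁ p₂

/-! ## §3 Glue and the item -/

/-- **UNION of two adjacent `U`-cells** (M19 family on the strip, full slot range `[−27/50, −13/25]`). [folklore] -/
theorem covHg1201M19_leftEdgeStrip_union {a b c : ℝ}
    (h₁ : ∀ n ∈ Set.Icc (43 / 50 : ℝ) (22 / 25), ∀ σ ∈ Set.Icc (-27 / 50 : ℝ) (-13 / 25), ∀ U' ∈ Set.Icc a b,
      ∀ (ω : InfVolFermionState 2) (Ls : ℕ → ℕ) (ψ : ∀ L, Fock (Orb (FermionTorus 2 L))),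
      Tendsto Ls atTop atTop →
      (∀ j, IsGroundStateInSector (hubbardTorusTT' (Ls j) 1 (-27 / 50) U') (rectN n (Ls j)) 0 (ψ (Ls j))) →
      (∀ j, star (ψ (Ls j)) ⬝ᵥ ψ (Ls j) = 1) → ω.IsTorusLimitOf ψ Ls →
      -(5084577 / 10000000 : ℝ) ≤ ((Finset.univ : Finset (DihedralGroup 4)).card : ℝ)⁻¹ * ∑ g ∈ (Finset.univ : Finset (DihedralGroup 4)),
        (ω.expect (d4ShiftSet g 0 (box 2 7)) (fermionEmbed (PolySite.d4Emb g 0 (box 2 7)) (-oddMomentObsTT σ U' 0))).re)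
    (h₂ : ∀ n ∈ Set.Icc (43 / 50 : ℝ) (22 / 25), ∀ σ ∈ Set.Icc (-27 / 50 : ℝ) (-13 / 25), ∀ U' ∈ Set.Icc b c,
      ∀ (ω : InfVolFermionState 2) (Ls : ℕ → ℕ) (ψ : ∀ L, Fock (Orb (FermionTorus 2 L))),
      Tendsto Ls atTop atTop →
      (∀ j, IsGroundStateInSector (hubbardTorusTT' (Ls j) 1 (-27 / 50) U') (rectN n (Ls j)) 0 (ψ (Ls j))) →
      (∀ j, star (ψ (Ls j)) ⬝ᵥ ψ (Ls j) = 1) → ω.IsTorusLimitOf ψ Ls →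
      -(5084577 / 10000000 : ℝ) ≤ ((Finset.univ : Finset (DihedralGroup 4)).card : ℝ)⁻¹ * ∑ g ∈ (Finset.univ : Finset (DihedralGroup 4)),
        (ω.expect (d4ShiftSet g 0 (box 2 7)) (fermionEmbed (PolySite.d4Emb g 0 (box 2 7)) (-oddMomentObsTT σ U' 0))).re) :
    ∀ n ∈ Set.Icc (43 / 50 : ℝ) (22 / 25), ∀ σ ∈ Set.Icc (-27 / 50 : ℝ) (-13 / 25), ∀ U' ∈ Set.Icc a c,
      ∀ (ω : InfVolFermionState 2) (Ls : ℕ → ℕ) (ψ : ∀ L, Fock (Orb (FermionTorus 2 L))),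
      Tendsto Ls atTop atTop →
      (∀ j, IsGroundStateInSector (hubbardTorusTT' (Ls j) 1 (-27 / 50) U') (rectN n (Ls j)) 0 (ψ (Ls j))) →
      (∀ j, star (ψ (Ls j)) ⬝ᵥ ψ (Ls j) = 1) → ω.IsTorusLimitOf ψ Ls →
      -(5084577 / 10000000 : ℝ) ≤ ((Finset.univ : Finset (DihedralGroup 4)).card : ℝ)⁻¹ * ∑ g ∈ (Finset.univ : Finset (DihedralGroup 4)),
        (ω.expect (d4ShiftSet g 0 (box 2 7)) (fermionEmbed (PolySite.d4Emb g 0 (box 2 7)) (-oddMomentObsTT σ U' 0))).re := by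
  intro n hn σ hσ U' hU' ω Ls ψ hLs hψ h1 hω
  rcases le_or_gt U' b with hle | hgt
  · exact h₁ n hn σ hσ U' ⟨hU'.1, hle⟩ ω Ls ψ hLs hψ h1 hω
  · exact h₂ n hn σ hσ U' ⟨hgt.le, hU'.2⟩ ω Ls ψ hLs hψ h1 hω

/-- **A CHAIN of consecutive cells** `l 0, …, l k` (`k ≠ 0`). [folklore] -/
theorem covHg1201M19_leftEdgeStrip_of_chain (l : ℕ → ℝ) (k : ℕ) (hk0 : k ≠ 0)
    (fam : ∀ i < k, ∀ n ∈ Set.Icc (43 / 50 : ℝ) (22 / 25), ∀ σ ∈ Set.Icc (-27 / 50 : ℝ) (-13 / 25), ∀ U' ∈ Set.Icc (l i) (l (i + 1)),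
      ∀ (ω : InfVolFermionState 2) (Ls : ℕ → ℕ) (ψ : ∀ L, Fock (Orb (FermionTorus 2 L))),
      Tendsto Ls atTop atTop →
      (∀ j, IsGroundStateInSector (hubbardTorusTT' (Ls j) 1 (-27 / 50) U') (rectN n (Ls j)) 0 (ψ (Ls j))) →
      (∀ j, star (ψ (Ls j)) ⬝ᵥ ψ (Ls j) = 1) → ω.IsTorusLimitOf ψ Ls →
      -(5084577 / 10000000 : ℝ) ≤ ((Finset.univ : Finset (DihedralGroup 4)).card : ℝ)⁻¹ * ∑ g ∈ (Finset.univ : Finset (DihedralGroup 4)),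
        (ω.expect (d4ShiftSet g 0 (box 2 7)) (fermionEmbed (PolySite.d4Emb g 0 (box 2 7)) (-oddMomentObsTT σ U' 0))).re) :
    ∀ n ∈ Set.Icc (43 / 50 : ℝ) (22 / 25), ∀ σ ∈ Set.Icc (-27 / 50 : ℝ) (-13 / 25), ∀ U' ∈ Set.Icc (l 0) (l k),
      ∀ (ω : InfVolFermionState 2) (Ls : ℕ → ℕ) (ψ : ∀ L, Fock (Orb (FermionTorus 2 L))),
      Tendsto Ls atTop atTop →
      (∀ j, IsGroundStateInSector (hubbardTorusTT' (Ls j) 1 (-27 / 50) U') (rectN n (Ls j)) 0 (ψ (Ls j))) →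
      (∀ j, star (ψ (Ls j)) ⬝ᵥ ψ (Ls j) = 1) → ω.IsTorusLimitOf ψ Ls →
      -(5084577 / 10000000 : ℝ) ≤ ((Finset.univ : Finset (DihedralGroup 4)).card : ℝ)⁻¹ * ∑ g ∈ (Finset.univ : Finset (DihedralGroup 4)),
        (ω.expect (d4ShiftSet g 0 (box 2 7)) (fermionEmbed (PolySite.d4Emb g 0 (box 2 7)) (-oddMomentObsTT σ U' 0))).re := by
  have main : ∀ j ≤ k, j ≠ 0 → ∀ n ∈ Set.Icc (43 / 50 : ℝ) (22 / 25), ∀ σ ∈ Set.Icc (-27 / 50 : ℝ) (-13 / 25), ∀ U' ∈ Set.Icc (l 0) (l j),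
      ∀ (ω : InfVolFermionState 2) (Ls : ℕ → ℕ) (ψ : ∀ L, Fock (Orb (FermionTorus 2 L))),
      Tendsto Ls atTop atTop →
      (∀ j, IsGroundStateInSector (hubbardTorusTT' (Ls j) 1 (-27 / 50) U') (rectN n (Ls j)) 0 (ψ (Ls j))) →
      (∀ j, star (ψ (Ls j)) ⬝ᵥ ψ (Ls j) = 1) → ω.IsTorusLimitOf ψ Ls →
      -(5084577 / 10000000 : ℝ) ≤ ((Finset.univ : Finset (DihedralGroup 4)).card : ℝ)⁻¹ * ∑ g ∈ (Finset.univ : Finset (DihedralGroup 4)),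
        (ω.expect (d4ShiftSet g 0 (box 2 7)) (fermionEmbed (PolySite.d4Emb g 0 (box 2 7)) (-oddMomentObsTT σ U' 0))).re := by
    intro j
    induction j with
    | zero => intro _ h; exact absurd rfl h
    | succ m ih =>
      intro hm _
      rcases Nat.eq_zero_or_pos m with hz | hpos
      · subst hz; exact fam 0 (by omega)
      · exact covHg1201M19_leftEdgeStrip_union (ih (by omega) (by omega)) (fam m (by omega))
  exact main k le_rfl hk0

/-- **«PatchLeftEdgeM19» (stmt-Ventures-27755) from the family on the FULL edge `[7/2, 44/5]`** (slots restricted from `[−27/50, −13/25]` to the item's `[−27/50, −53/100]`).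
[cite: ScalapinoWhiteZhang1993, §II] -/
theorem covHg1201M19_PatchLeftEdgeM19_of_leftEdgeStrip
    (h : ∀ n ∈ Set.Icc (43 / 50 : ℝ) (22 / 25), ∀ σ ∈ Set.Icc (-27 / 50 : ℝ) (-13 / 25), ∀ U' ∈ Set.Icc (7 / 2 : ℝ) (44 / 5),
      ∀ (ω : InfVolFermionState 2) (Ls : ℕ → ℕ) (ψ : ∀ L, Fock (Orb (FermionTorus 2 L))),
      Tendsto Ls atTop atTop →
      (∀ j, IsGroundStateInSector (hubbardTorusTT' (Ls j) 1 (-27 / 50) U') (rectN n (Ls j)) 0 (ψ (Ls j))) →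
      (∀ j, star (ψ (Ls j)) ⬝ᵥ ψ (Ls j) = 1) → ω.IsTorusLimitOf ψ Ls →
      -(5084577 / 10000000 : ℝ) ≤ ((Finset.univ : Finset (DihedralGroup 4)).card : ℝ)⁻¹ * ∑ g ∈ (Finset.univ : Finset (DihedralGroup 4)),
        (ω.expect (d4ShiftSet g 0 (box 2 7)) (fermionEmbed (PolySite.d4Emb g 0 (box 2 7)) (-oddMomentObsTT σ U' 0))).re) :
    PatchLeftEdgeM19 := by
  unfold PatchLeftEdgeM19
  intro n hn σ hσ U' hU' ω Ls ψ hLs hψ h1 hω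
  exact h n hn σ ⟨hσ.1, hσ.2.trans (by norm_num)⟩ U' hU' ω Ls ψ hLs hψ h1 hω

/-- **«PatchLeftEdgeM19» from TWO cells** (breakpoint `b`). [cite: ScalapinoWhiteZhang1993, §II] -/
theorem covHg1201M19_PatchLeftEdgeM19_of_twoCells {b : ℝ}
    (h₁ : ∀ n ∈ Set.Icc (43 / 50 : ℝ) (22 / 25), ∀ σ ∈ Set.Icc (-27 / 50 : ℝ) (-13 / 25), ∀ U' ∈ Set.Icc (7 / 2 : ℝ) b,
      ∀ (ω : InfVolFermionState 2) (Ls : ℕ → ℕ) (ψ : ∀ L, Fock (Orb (FermionTorus 2 L))),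
      Tendsto Ls atTop atTop →
      (∀ j, IsGroundStateInSector (hubbardTorusTT' (Ls j) 1 (-27 / 50) U') (rectN n (Ls j)) 0 (ψ (Ls j))) →
      (∀ j, star (ψ (Ls j)) ⬝ᵥ ψ (Ls j) = 1) → ω.IsTorusLimitOf ψ Ls →
      -(5084577 / 10000000 : ℝ) ≤ ((Finset.univ : Finset (DihedralGroup 4)).card : ℝ)⁻¹ * ∑ g ∈ (Finset.univ : Finset (DihedralGroup 4)),
        (ω.expect (d4ShiftSet g 0 (box 2 7)) (fermionEmbed (PolySite.d4Emb g 0 (box 2 7)) (-oddMomentObsTT σ U' 0))).re)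
    (h₂ : ∀ n ∈ Set.Icc (43 / 50 : ℝ) (22 / 25), ∀ σ ∈ Set.Icc (-27 / 50 : ℝ) (-13 / 25), ∀ U' ∈ Set.Icc b (44 / 5),
      ∀ (ω : InfVolFermionState 2) (Ls : ℕ → ℕ) (ψ : ∀ L, Fock (Orb (FermionTorus 2 L))),
      Tendsto Ls atTop atTop →
      (∀ j, IsGroundStateInSector (hubbardTorusTT' (Ls j) 1 (-27 / 50) U') (rectN n (Ls j)) 0 (ψ (Ls j))) →
      (∀ j, star (ψ (Ls j)) ⬝ᵥ ψ (Ls j) = 1) → ω.IsTorusLimitOf ψ Ls →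
      -(5084577 / 10000000 : ℝ) ≤ ((Finset.univ : Finset (DihedralGroup 4)).card : ℝ)⁻¹ * ∑ g ∈ (Finset.univ : Finset (DihedralGroup 4)),
        (ω.expect (d4ShiftSet g 0 (box 2 7)) (fermionEmbed (PolySite.d4Emb g 0 (box 2 7)) (-oddMomentObsTT σ U' 0))).re) :
    PatchLeftEdgeM19 :=
  covHg1201M19_PatchLeftEdgeM19_of_leftEdgeStrip (covHg1201M19_leftEdgeStrip_union h₁ h₂)

/-- **«PatchLeftEdgeM19» from FOUR cells** (breakpoints `b₁ b₂ b₃`). [cite: ScalapinoWhiteZhang1993, §II] -/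
theorem covHg1201M19_PatchLeftEdgeM19_of_fourCells {b₁ b₂ b₃ : ℝ}
    (h₁ : ∀ n ∈ Set.Icc (43 / 50 : ℝ) (22 / 25), ∀ σ ∈ Set.Icc (-27 / 50 : ℝ) (-13 / 25), ∀ U' ∈ Set.Icc (7 / 2 : ℝ) b₁,
      ∀ (ω : InfVolFermionState 2) (Ls : ℕ → ℕ) (ψ : ∀ L, Fock (Orb (FermionTorus 2 L))),
      Tendsto Ls atTop atTop →
      (∀ j, IsGroundStateInSector (hubbardTorusTT' (Ls j) 1 (-27 / 50) U') (rectN n (Ls j)) 0 (ψ (Ls j))) →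
      (∀ j, star (ψ (Ls j)) ⬝ᵥ ψ (Ls j) = 1) → ω.IsTorusLimitOf ψ Ls →
      -(5084577 / 10000000 : ℝ) ≤ ((Finset.univ : Finset (DihedralGroup 4)).card : ℝ)⁻¹ * ∑ g ∈ (Finset.univ : Finset (DihedralGroup 4)),
        (ω.expect (d4ShiftSet g 0 (box 2 7)) (fermionEmbed (PolySite.d4Emb g 0 (box 2 7)) (-oddMomentObsTT σ U' 0))).re)
    (h₂ : ∀ n ∈ Set.Icc (43 / 50 : ℝ) (22 / 25), ∀ σ ∈ Set.Icc (-27 / 50 : ℝ) (-13 / 25), ∀ U' ∈ Set.Icc b₁ b₂,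
      ∀ (ω : InfVolFermionState 2) (Ls : ℕ → ℕ) (ψ : ∀ L, Fock (Orb (FermionTorus 2 L))),
      Tendsto Ls atTop atTop →
      (∀ j, IsGroundStateInSector (hubbardTorusTT' (Ls j) 1 (-27 / 50) U') (rectN n (Ls j)) 0 (ψ (Ls j))) →
      (∀ j, star (ψ (Ls j)) ⬝ᵥ ψ (Ls j) = 1) → ω.IsTorusLimitOf ψ Ls →
      -(5084577 / 10000000 : ℝ) ≤ ((Finset.univ : Finset (DihedralGroup 4)).card : ℝ)⁻¹ * ∑ g ∈ (Finset.univ : Finset (DihedralGroup 4)),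
        (ω.expect (d4ShiftSet g 0 (box 2 7)) (fermionEmbed (PolySite.d4Emb g 0 (box 2 7)) (-oddMomentObsTT σ U' 0))).re)
    (h₃ : ∀ n ∈ Set.Icc (43 / 50 : ℝ) (22 / 25), ∀ σ ∈ Set.Icc (-27 / 50 : ℝ) (-13 / 25), ∀ U' ∈ Set.Icc b₂ b₃,
      ∀ (ω : InfVolFermionState 2) (Ls : ℕ → ℕ) (ψ : ∀ L, Fock (Orb (FermionTorus 2 L))),
      Tendsto Ls atTop atTop →
      (∀ j, IsGroundStateInSector (hubbardTorusTT' (Ls j) 1 (-27 / 50) U') (rectN n (Ls j)) 0 (ψ (Ls j))) →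
      (∀ j, star (ψ (Ls j)) ⬝ᵥ ψ (Ls j) = 1) → ω.IsTorusLimitOf ψ Ls →
      -(5084577 / 10000000 : ℝ) ≤ ((Finset.univ : Finset (DihedralGroup 4)).card : ℝ)⁻¹ * ∑ g ∈ (Finset.univ : Finset (DihedralGroup 4)),
        (ω.expect (d4ShiftSet g 0 (box 2 7)) (fermionEmbed (PolySite.d4Emb g 0 (box 2 7)) (-oddMomentObsTT σ U' 0))).re)
    (h₄ : ∀ n ∈ Set.Icc (43 / 50 : ℝ) (22 / 25), ∀ σ ∈ Set.Icc (-27 / 50 : ℝ) (-13 / 25), ∀ U' ∈ Set.Icc b₃ (44 / 5),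
      ∀ (ω : InfVolFermionState 2) (Ls : ℕ → ℕ) (ψ : ∀ L, Fock (Orb (FermionTorus 2 L))),
      Tendsto Ls atTop atTop →
      (∀ j, IsGroundStateInSector (hubbardTorusTT' (Ls j) 1 (-27 / 50) U') (rectN n (Ls j)) 0 (ψ (Ls j))) →
      (∀ j, star (ψ (Ls j)) ⬝ᵥ ψ (Ls j) = 1) → ω.IsTorusLimitOf ψ Ls →
      -(5084577 / 10000000 : ℝ) ≤ ((Finset.univ : Finset (DihedralGroup 4)).card : ℝ)⁻¹ * ∑ g ∈ (Finset.univ : Finset (DihedralGroup 4)),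
        (ω.expect (d4ShiftSet g 0 (box 2 7)) (fermionEmbed (PolySite.d4Emb g 0 (box 2 7)) (-oddMomentObsTT σ U' 0))).re) :
    PatchLeftEdgeM19 :=
  covHg1201M19_PatchLeftEdgeM19_of_leftEdgeStrip
    (covHg1201M19_leftEdgeStrip_union (covHg1201M19_leftEdgeStrip_union (covHg1201M19_leftEdgeStrip_union h₁ h₂) h₃) h₄)

/-- **«PatchLeftEdgeM19» from a CHAIN of cells** `7/2 = l 0, …, l k = 44/5`. [cite: ScalapinoWhiteZhang1993, §II] -/
theorem covHg1201M19_PatchLeftEdgeM19_of_chain (l : ℕ → ℝ) (k : ℕ) (hk0 : k ≠ 0) (h0 : l 0 = 7 / 2) (hk : l k = 44 / 5)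
    (fam : ∀ i < k, ∀ n ∈ Set.Icc (43 / 50 : ℝ) (22 / 25), ∀ σ ∈ Set.Icc (-27 / 50 : ℝ) (-13 / 25), ∀ U' ∈ Set.Icc (l i) (l (i + 1)),
      ∀ (ω : InfVolFermionState 2) (Ls : ℕ → ℕ) (ψ : ∀ L, Fock (Orb (FermionTorus 2 L))),
      Tendsto Ls atTop atTop →
      (∀ j, IsGroundStateInSector (hubbardTorusTT' (Ls j) 1 (-27 / 50) U') (rectN n (Ls j)) 0 (ψ (Ls j))) →
      (∀ j, star (ψ (Ls j)) ⬝ᵥ ψ (Ls j) = 1) → ω.IsTorusLimitOf ψ Ls →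
      -(5084577 / 10000000 : ℝ) ≤ ((Finset.univ : Finset (DihedralGroup 4)).card : ℝ)⁻¹ * ∑ g ∈ (Finset.univ : Finset (DihedralGroup 4)),
        (ω.expect (d4ShiftSet g 0 (box 2 7)) (fermionEmbed (PolySite.d4Emb g 0 (box 2 7)) (-oddMomentObsTT σ U' 0))).re) :
    PatchLeftEdgeM19 := by
  have h := covHg1201M19_leftEdgeStrip_of_chain l k hk0 fam
  rw [h0, hk] at h
  exact covHg1201M19_PatchLeftEdgeM19_of_leftEdgeStrip h

end Summit.Ventures.CertifiedManyBodySolver.Theorems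

end
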